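import Summits.BirchSwinnertonDyer.Rank1Residual.O5.FullLocalThreeTorsionBadPrimes
import Literature.NumberTheory.EllipticCurves.LangHeightKodairaNeronProofs
import HarnessLib

/-!
# Full local `3`-torsion at a prime `ℓ ≠ 3`: additive reduction is excluded, bad reduction is
# SPLIT multiplicative with `3 ∣ v_ℓ(Δ_min)` — "Thm 7 (d)" as printed
# (cell `b2b-bsdres`, lane CLASS-CLOSURE, class O5; harvest seat 2, GEN 57, E114; sequel to E112/E113)

HONEST FRAMING (cell `b2b-bsdres`, run/shared/lean/b2b/bsd-rank1-residual/, verbatim in every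
file): the goal of the cell is to DELETE the COMBINATION-SHAPED residual classes of the
Birch–Swinnerton-Dyer formula for ALL analytic-rank `≤ 1` elliptic curves over `ℚ` — "full BSD
formula for every rank `≤ 1` curve in class `C`" assembled STRICTLY from published theorems — so
that the rank-`≤ 1` remainder becomes exactly the CONSTRUCTION-SHAPED classes, which are TYPED
(missing-input `Prop`s), NOT attempted. This is not "finishing BSD". Lane CLASS-CLOSURE: research
routes; no claim beyond the stated classes; census output is EVIDENCE, never a Literature fact;
nothing is booked here; no mark of `RESIDUAL-MAP.md` moves; O5 stays OPEN. THEOREMS ONLY (no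
definition, no named fact, no `@[conjecture]` node, no `sorry`; net named-fact debt `0`); no node
file and no vocabulary file is touched.

## What this file does

The census predicate `FullLocalThreeTorsionAt W ℓ` (`O5/O5UncleanParity.lean`, "`h⁰(ℚ_ℓ, W[3]) = 2`")
carries in its docstring the sentence "For `ℓ ≠ 3` this forces `ℓ ≡ 1 (mod 3)` and good or split
multiplicative reduction with `3 ∣ v_ℓ(Δ)` (Thm 7 (d))". E112 (`O5/FullLocalThreeTorsionMuThree.lean`)
proved `ℓ ≡ 1 (mod 3)` (Weil pairing); E113 (`O5/FullLocalThreeTorsionBadPrimes.lean`) proved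
`3 ∣ c_ℓ` at a bad `ℓ ≠ 3`. This file finishes the sentence:

* §4a `nine_le_index_of_pair` (group theory: a pair of independent `3`-torsion elements gives nine
  cosets of a `3`-torsion-free subgroup) and **`not_exists_pair_three_nsmul_of_addv` /
  `not_fullLocalThreeTorsionAt_of_addv`** — at an ADDITIVE prime `q ≠ 3`, `h⁰(ℚ_q, W[3]) ≤ 1`:
  `E₀(ℚ_q)` has no `3`-torsion (cusp; tree `CuspDivision`, x11b3-p4) and
  `c_q = [E(ℚ_q) : E₀(ℚ_q)] ≤ 4` (Kodaira–Néron; tree `kodairaNeron_tamagawaNumberAt`,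
  `LangHeightKodairaNeronProofs.lean`, read over `ℤ_[q]` by the `Additive/` bridge
  `localTamagawaNumber_padic_eq_placeOf`), so nine cosets do not fit. (E113 §3's "`3 ∣ c_q` at an
  additive prime with full local `3`-torsion" is thereby vacuous.)
* §4b **`hasSplitMultiplicativeReductionAt_of_fullLocalThreeTorsionAt_of_not_good`** — at a BAD
  prime `q ≠ 3`, full local `3`-torsion forces SPLIT multiplicative reduction with
  `3 ∣ v_q(Δ_min)` (tree currency `HasSplitMultiplicativeReductionAt` / `ordMinimalDiscriminant` at
  the place `placeOf q` of `ℤ`): additive is excluded (§4a), multiplicative gives `3 ∣ c_q` (E113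
  §2), a non-split `c_q` is `1` or `2` (Silverman *ATAEC* IV.9.4 Step 2; tree
  `localTamagawaNumber_of_hasNonsplitMultiplicativeReductionAt_holds`), and split gives
  `c_q = v_q(Δ_min)` (Kodaira–Néron); and the one-statement form
  **`mod_three_eq_one_and_good_or_split_of_fullLocalThreeTorsionAt`**: for `q ≠ 3`,
  `FullLocalThreeTorsionAt W q → q % 3 = 1 ∧ (good q ∨ (split multiplicative at q ∧ 3 ∣ v_q(Δ_min)))`.

Nothing about any particular curve is asserted; the census count stays EVIDENCE; no node is
discharged.

References: J. H. Silverman, *The Arithmetic of Elliptic Curves*, 2nd ed. (2009), VII.2 Prop. 2.1,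
VII.3 Prop. 3.1 (a), VII.5 Prop. 5.1, Thm. VII.6.1 (Kodaira–Néron), Cor. III.8.1.1
[SilvermanAEC2009]; *Advanced Topics* (1994), IV.9 Remark 9.2.2, Cor. IV.9.2 (d), IV.9.4 Step 2
[SilvermanATAEC1994]; cell: `O5/O5UncleanParity.lean` §1 (o5-r1 T25 / cc-typer-5),
`O5/FullLocalThreeTorsionMuThree.lean` (E112), `O5/FullLocalThreeTorsionBadPrimes.lean` (E113),
`O5/AdditiveTamagawaThreeInvariantHolds.lean` (E110, the `ℤ_q`-minimal-model template),
`Additive/LocalThreeTorsionIffTamagawaThreeOfIVHolds.lean` (`placeOf` bridges),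
`Literature/…/LangHeightKodairaNeronProofs.lean` (Kodaira–Néron over `ℚ`),
HOME/b2b-bsdres-harvest-2/gen57/E114.

## Design

No definitions; `noncomputable section`; `open scoped Classical`. Axioms of every declaration:
`propext`, `Classical.choice`, `Quot.sound`.
-/

set_option autoImplicit false

noncomputable section

open scoped Classical

namespace Summit.BirchSwinnertonDyer.Rank1Residual.O5

open WeierstrassCurve Literature.NumberTheory.EllipticCurves
  Literature.NumberTheory.EllipticCurves.Rank1Residual
  Summit.BirchSwinnertonDyer.Rank1Residual.Additive

/-! ## §4a Additive primes `q ≠ 3` have `h⁰(ℚ_q, W[3]) ≤ 1` -/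

section Split

variable (W : WeierstrassCurve ℚ) [W.IsElliptic] (q : ℕ) [hq : Fact q.Prime]

/-- **Nine cosets.** If a subgroup `H ≤ A` of finite index has no `3`-torsion, a pair `P, Q` of
elements of order `3` with `Q ≠ ±P` gives nine distinct cosets `aP + bQ + H` (`a, b < 3`;
E112's `pair_nsmul_injective`), so `9 ≤ [A : H]`. [folklore] -/
theorem nine_le_index_of_pair {A : Type*} [AddCommGroup A] (H : AddSubgroup A)
    (hH : ∀ x ∈ H, 3 • x = 0 → x = 0) (hfin : H.index ≠ 0) {P Q : A} (hP0 : P ≠ 0)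
    (hQ0 : Q ≠ 0) (hP3 : 3 • P = 0) (hQ3 : 3 • Q = 0) (hQP : Q ≠ P) (hQnP : Q ≠ -P) :
    9 ≤ H.index := by
  haveI : Finite (A ⧸ H) := Nat.finite_of_card_ne_zero hfin
  have hinj := pair_nsmul_injective hP3 hQ3 hP0 hQ0 hQP hQnP
  have h3 : ∀ ab : Fin 3 × Fin 3, 3 • ((ab.1 : ℕ) • P + (ab.2 : ℕ) • Q) = 0 := fun ab ↦ by
    rw [nsmul_add, smul_comm 3 (ab.1 : ℕ) P, smul_comm 3 (ab.2 : ℕ) Q, hP3, hQ3, smul_zero,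
      smul_zero, add_zero]
  have hf : Function.Injective
      (fun ab : Fin 3 × Fin 3 ↦ (((ab.1 : ℕ) • P + (ab.2 : ℕ) • Q : A) : A ⧸ H)) := by
    intro ab cd h
    apply hinj
    have hmem := QuotientAddGroup.eq.mp h
    have h0 := hH _ hmem (by rw [nsmul_add, neg_nsmul, h3 ab, h3 cd, neg_zero, add_zero])
    exact neg_add_eq_zero.mp h0
  show 9 ≤ Nat.card (A ⧸ H)
  simpa using Nat.card_le_card_of_injective _ hf

/-- **At an ADDITIVE prime `q ≠ 3` there is no pair of independent `3`-torsion points over `ℚ_q`**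
(`h⁰(ℚ_q, W[3]) ≤ 1`). On the chosen `ℤ_q`-minimal model `C • (W ⊗ ℚ_q) = I ⊗ ℚ_q` (additive
reduction, `hasAdditiveReduction_minimal_padic_of_addv`; the E110 §1 template): `E₀(ℚ_q)` has no
`3`-torsion (cusp: `Ẽ_ns(k) = k⁺` has none as `char k ≠ 3`, and `E₁(ℚ_q)` has none as `3 ∈ ℤ_q^×`;
tree `CuspDivision.eq_zero_of_nsmul_eq_zero_of_hasNonsingularReduction`, x11b3-p4, Silverman *AEC*
VII.2.1, VII.3.1 (a), *ATAEC* IV.9 Rem. 9.2.2), so a pair would give nine cosets of `E₀(ℚ_q)`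
(`nine_le_index_of_pair`); but `c_q = [E(ℚ_q) : E₀(ℚ_q)] ≤ 4` at a place that is not split
multiplicative (Kodaira–Néron, tree `kodairaNeron_tamagawaNumberAt` at `placeOf q`, read over
`ℤ_[q]` by `localTamagawaNumber_padic_eq_placeOf` and the prime/place bridge
`hasMultiplicativeReductionAtPrime_iff_hasMultiplicativeReductionAt_holds`).
[cite: SilvermanAEC2009, Thm. VII.6.1, VII.2 Prop. 2.1, VII.3 Prop. 3.1 (a)]
[cite: SilvermanATAEC1994, IV.9 Remark 9.2.2 and Cor. IV.9.2 (d)] -/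
theorem not_exists_pair_three_nsmul_of_addv (hq3 : q ≠ 3) (hadd : Addv W q) :
    ¬ ∃ P Q : (W.baseChange ℚ_[q]).toAffine.Point,
        P ≠ 0 ∧ Q ≠ 0 ∧ 3 • P = 0 ∧ 3 • Q = 0 ∧ Q ≠ P ∧ Q ≠ -P := by
  haveI : Finite (IsLocalRing.ResidueField ℤ_[q]) :=
    Finite.of_equiv (ZMod q) (PadicInt.residueField (p := q)).symm.toEquiv
  -- the chosen `ℤ_[q]`-minimal model `M = C • (W ⊗ ℚ_q) = I ⊗ ℚ_q` has additive reduction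
  haveI hM : ((W.baseChange ℚ_[q]).minimal ℤ_[q]).HasAdditiveReduction ℤ_[q] :=
    hasAdditiveReduction_minimal_padic_of_addv W q hadd
  obtain ⟨C, hC⟩ : ∃ C : VariableChange ℚ_[q],
      (W.baseChange ℚ_[q]).minimal ℤ_[q] = C • W.baseChange ℚ_[q] := ⟨_, rfl⟩
  obtain ⟨I, hI⟩ : ∃ I : WeierstrassCurve ℤ_[q],
      (W.baseChange ℚ_[q]).minimal ℤ_[q] = I.baseChange ℚ_[q] := IsIntegral.integral
  haveI hIadd : (I.baseChange ℚ_[q]).HasAdditiveReduction ℤ_[q] := hI ▸ hM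
  haveI : (I.baseChange ℚ_[q]).IsElliptic := by rw [← hI, hC]; infer_instance
  -- `c_q` is the index of `E₀(ℚ_q)` of `I`; it is finite and `≤ 4`
  have hc : (W.baseChange ℚ_[q]).localTamagawaNumber ℤ_[q] =
      (I.nonsingularReductionSubgroup (integers_valuationRing_valuation ℤ_[q] ℚ_[q])).index := by
    change (((W.baseChange ℚ_[q]).minimal ℤ_[q]).goodReductionSubgroup ℤ_[q]).index = _
    rw [index_goodReductionSubgroup_congr_of_eq hI, goodReductionSubgroup_baseChange_eq]
  have hfin : (I.nonsingularReductionSubgroup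
      (integers_valuationRing_valuation ℤ_[q] ℚ_[q])).index ≠ 0 := by
    rw [← hc]; exact localTamagawaNumber_padic_ne_zero_holds q (W.baseChange ℚ_[q])
  have hle4 : (W.baseChange ℚ_[q]).localTamagawaNumber ℤ_[q] ≤ 4 := by
    rw [localTamagawaNumber_padic_eq_placeOf W q]
    refine (kodairaNeron_tamagawaNumberAt W (placeOf q)).2.2 fun hs ↦ hadd.2 ?_
    exact (W.hasMultiplicativeReductionAtPrime_iff_hasMultiplicativeReductionAt_holds
      ⟨q, hq.out⟩).mpr hs.hasMultiplicativeReductionAt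
  have hu : IsUnit ((3 : ℕ) : ℤ_[q]) := isUnit_three_padicInt q hq3
  -- transport of the pair along `W ⊗ ℚ_q ≃ C • (W ⊗ ℚ_q) = I ⊗ ℚ_q`, then nine cosets
  intro hpair
  obtain ⟨P, Q, hP0, hQ0, hP3, hQ3, hQP, hQnP⟩ := exists_pair_three_nsmul_of_addEquiv
    ((VariableChange.pointEquiv (W.baseChange ℚ_[q]) C).trans
      (Affine.Point.congrEquiv (hC.symm.trans hI))) hpair
  have h9 := nine_le_index_of_pair
    (I.nonsingularReductionSubgroup (integers_valuationRing_valuation ℤ_[q] ℚ_[q]))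
    (fun g hg h0 ↦ CuspDivision.eq_zero_of_nsmul_eq_zero_of_hasNonsingularReduction ℤ_[q] I
      (integers_valuationRing_valuation ℤ_[q] ℚ_[q]) hu
      ((I.mem_nonsingularReductionSubgroup_iff _).mp hg) h0)
    hfin hP0 hQ0 hP3 hQ3 hQP hQnP
  rw [← hc] at h9
  omega

/-- **`¬ FullLocalThreeTorsionAt W q` at every ADDITIVE prime `q ≠ 3`** (`h⁰(ℚ_q, W[3]) ≤ 1`;
E111's `exists_pair_three_nsmul_iff_fullLocalThreeTorsionAt`). In particular E113 §3's
`3 ∣ c_q` at an additive prime with full local `3`-torsion is vacuous: additive primes `≠ 3` never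
carry it. [cite: SilvermanAEC2009, Thm. VII.6.1 (Kodaira–Néron)]
[cite: SilvermanATAEC1994, IV.9 Remark 9.2.2] -/
theorem not_fullLocalThreeTorsionAt_of_addv (hq3 : q ≠ 3) (hadd : Addv W q) :
    ¬ FullLocalThreeTorsionAt W q := fun h ↦
  not_exists_pair_three_nsmul_of_addv W q hq3 hadd
    ((exists_pair_three_nsmul_iff_fullLocalThreeTorsionAt W q).mpr h)

/-! ## §4b At a bad prime `q ≠ 3`, full local `3`-torsion means SPLIT multiplicative reduction
with `3 ∣ v_q(Δ_min)` -/

/-- A BAD prime `q ≠ 3` carrying full local `3`-torsion is MULTIPLICATIVE (§4a). [folklore] -/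
theorem mult_of_fullLocalThreeTorsionAt_of_not_good (hq3 : q ≠ 3)
    (hbad : ¬ W.HasGoodReductionAtPrime q) (h : FullLocalThreeTorsionAt W q) : Mult W q := by
  by_contra hm
  exact not_fullLocalThreeTorsionAt_of_addv W q hq3 ⟨hbad, hm⟩ h

/-- **"Thm 7 (d)" at a bad prime, as printed: full local `3`-torsion at a prime `q ≠ 3` of BAD
reduction forces SPLIT multiplicative reduction at `q` with `3 ∣ v_q(Δ_min)`** (tree currency:
`HasSplitMultiplicativeReductionAt` / `ordMinimalDiscriminant` at the place `placeOf q` of `ℤ`).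
Additive is excluded (`not_fullLocalThreeTorsionAt_of_addv`); multiplicative gives `3 ∣ c_q` (E113 §2);
a NON-split `c_q` is `1` or `2` (Silverman *ATAEC* IV.9.4 Step 2; tree
`localTamagawaNumber_of_hasNonsplitMultiplicativeReductionAt_holds`), so the reduction is split and
then `c_q = v_q(Δ_min)` (Kodaira–Néron, tree `kodairaNeron_tamagawaNumberAt`). With E112
(`q ≡ 1 (mod 3)`) this is the whole sentence "for `ℓ ≠ 3` this forces `ℓ ≡ 1 (mod 3)` and good or
split multiplicative reduction with `3 ∣ v_ℓ(Δ)`" of the docstring of `FullLocalThreeTorsionAt`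
(`O5/O5UncleanParity.lean`), as a theorem. [cite: SilvermanAEC2009, Thm. VII.6.1 (Kodaira–Néron)]
[cite: SilvermanATAEC1994, IV.9.4 Step 2 (PDF p. 344)] -/
theorem hasSplitMultiplicativeReductionAt_of_fullLocalThreeTorsionAt_of_not_good (hq3 : q ≠ 3)
    (hbad : ¬ W.HasGoodReductionAtPrime q) (h : FullLocalThreeTorsionAt W q) :
    W.HasSplitMultiplicativeReductionAt (placeOf q) ∧
      3 ∣ W.ordMinimalDiscriminant (placeOf q) := by
  have hmult : Mult W q := mult_of_fullLocalThreeTorsionAt_of_not_good W q hq3 hbad h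
  obtain ⟨_, h3⟩ := pDvdTamagawaAt_three_of_fullLocalThreeTorsionAt_of_mult W q hq3 hmult h
  rw [localTamagawaNumber_padic_eq_placeOf W q] at h3
  have hmult' : W.HasMultiplicativeReductionAt (placeOf q) :=
    (W.hasMultiplicativeReductionAtPrime_iff_hasMultiplicativeReductionAt_holds ⟨q, hq.out⟩).mp
      hmult
  have hsplit : W.HasSplitMultiplicativeReductionAt (placeOf q) := by
    by_contra hns
    rw [localTamagawaNumber_of_hasNonsplitMultiplicativeReductionAt_holds (placeOf q) W hmult' hns]
      at h3
    split_ifs at h3 <;> omega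
  have hcΔ : (W.baseChange ((placeOf q).adicCompletion ℚ)).localTamagawaNumber
      ((placeOf q).adicCompletionIntegers ℚ) = W.ordMinimalDiscriminant (placeOf q) :=
    (kodairaNeron_tamagawaNumberAt W (placeOf q)).2.1 hsplit
  exact ⟨hsplit, hcΔ ▸ h3⟩

/-- **The T25 sentence in one statement**: for an elliptic `W/ℚ` and a prime `q ≠ 3` with
`h⁰(ℚ_q, W[3]) = 2`: `q ≡ 1 (mod 3)` (E112), and `q` is a prime of good reduction or of split
multiplicative reduction with `3 ∣ v_q(Δ_min)`. [cite: SilvermanAEC2009, Cor. III.8.1.1, Thm. VII.6.1] -/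
theorem mod_three_eq_one_and_good_or_split_of_fullLocalThreeTorsionAt (hq3 : q ≠ 3)
    (h : FullLocalThreeTorsionAt W q) :
    q % 3 = 1 ∧ (W.HasGoodReductionAtPrime q ∨
      (W.HasSplitMultiplicativeReductionAt (placeOf q) ∧
        3 ∣ W.ordMinimalDiscriminant (placeOf q))) := by
  refine ⟨mod_three_eq_one_of_fullLocalThreeTorsionAt W q h, ?_⟩
  by_cases hg : W.HasGoodReductionAtPrime q
  · exact Or.inl hg
  · exact Or.inr
      (hasSplitMultiplicativeReductionAt_of_fullLocalThreeTorsionAt_of_not_good W q hq3 hg h)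

end Split

end Summit.BirchSwinnertonDyer.Rank1Residual.O5

end
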